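/-
Copyright: the b2b-balaban T⁴-continuum CRUX team, row NE7b OWNER lineage `t4-ne7b-p1` (gen 145). Project licence.
-/
import Summits.QuantumFields.BalabanUV.T4Continuum.Spine.NE7b.SupWhitenedMixedThirdCumulantEntryTwo
import Summits.QuantumFields.BalabanUV.T4Continuum.Spine.NE7b.SupHomogeneousThreePoint

/-!
# THE HOMOGENEOUS BOUND AND THE INTERPOLATED THREE-POINT ENTRY, SECOND PLACEMENT (SCOPING-d17 (R-a), third file).  (650) treated the
# placement of (507)∕(508) — the row∕tilt index `x` INSIDE the Hessian pair, `κ₃(U″e_xe_y; U′e_z, U′e_t)`, decay `ρ_{xz}ρ_{xt}` — which covers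
# three of the six supported three-point terms of `M₄` ((526): `𝟙[Hk_{yx}]`, `𝟙[Hk_{zx}]`, `𝟙[Hk_{tx}]`).  The other three (`𝟙[Hk_{zy}]`,
# `𝟙[Hk_{ty}]`, `𝟙[Hk_{tz}]`) are (509)'s SECOND placement — `x` a gradient leg, the Hessian pair `(y,z)` in the middle:
# `κ₃(U′e_x; U″e_ye_z; U′e_t)` with the tree bound `Q = 4√(MK)∕(ρ_{xy}ρ_{xt})`.  Here the homogeneous bound for this placement (the bounded
# vertex in the middle; `|U″(·)[e_y,e_z]| ≤ Hk_{zy}`):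
#   `|E_ν(F_x − EF_x)(G_{yz} − EG_{yz})(F_t − EF_t)| ≤ P := 2·Hk_{zy}·√M₁`,   `M₁ = 5κ₂⁴γ_op²∕(1−λγ_op)²`
# (Gibbs format §2, tilted format §3 by (509)'s bridge) and THE END (§4) the interpolated entry
#   `|κ₃| ≤ √(P·4√(MK)) ∕ √(ρ_{xy}ρ_{xt})`
# ((649) `abs_le_sqrt_mul_of_le` with (509) `whitened_mixed_third_cumulant_entry_two`).  With (650) all six supported three-point terms of `M₄`
# have interpolated replacements (row NE7b, node U5c; (650) §1, (509), (465), (649) BY NAME; [folklore]).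

Cell `pub-balaban`, sub-cell `t4`, spine estimate NE7b (`T4WeightBudget.RelWeightBound`; the cell's OWN estimate — NOT PRINTED in
[Bałaban 1983–89], NOT PROVED).  Crux-route work under `Spine/NE7b/` by the row OWNER (`t4-ne7b-p1` gen 145, file (654)) under FREEZE
(0)'s crux-prover clause; NOTHING of Bałaban's is named as a Lean object, valued or asserted; no `T4Continuum/Support` leaf typed; no
`def`, no notation; zero `sorry`.  Imports (BY NAME): the OWNER's (509) `…SupWhitenedMixedThirdCumulantEntryTwo`, (650) `…SupHomogeneousThreePoint`
((649), (465), (458), (457) through them).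

WHAT IS PROVED ([folklore]): §1 `centred_triple_le_of_bounded_middle` (any probability measure); §2
        **`whitened_mixed_third_cumulant_homogeneous_two`**;
§3 **`homogeneous_mixed_third_cumulant_entry_two`**; §4 THE END **`interpolated_mixed_third_cumulant_entry_two`**; §5 toy.

HONEST (what this is NOT).  The second placement only; the interpolated ENTRY MAJORANT `M₄′` ((526)′), its weighted slot letters and the
order-5 placements (the `K3`-vertex terms, the two-rider and supported-tree terms) are the next files; the interpolation halves the decay
rate; scalar skeleton ((A3), NC-NE7b-α UNRULED); nothing of Bałaban's asserted.  BY-NAME EFFECT ON THE WALL: NONE.  NE7b NOT PRINTED ∕ NOT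
PROVED; spine PROVED 0∕9; rung (B)+1 — the programme's measures remain FINITE-torus statements; NOT the mass gap, NOT Clay.  HONEST DEPENDENCY:
continuum YM on T⁴ ⇐ BetaPertH ∧ nine spine estimates (0∕9 proved); BetaPertH ⇐ (D1) ∧ (D4) ∧ CAP+tail; G-an2-4 gates asym, D1 and NE2∕3∕4.
-/

set_option autoImplicit false
set_option maxSynthPendingDepth 2

noncomputable section

namespace Summit.QuantumFields.BalabanUV.T4Continuum.NE7b.SupHomogeneousThreePointTwo

open MeasureTheory ProbabilityTheory Real Set Function Finset Matrix
open scoped BigOperators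
open Literature.Probability.Distributions (matrixCLM)
open SupWhitenedFourthMoment (whitened_fourth_moment_gibbs whitened_fourth_power_integrable)
open SupWhitenedMomentLetters (op_letter_nonneg whitened_exp_integrable)
open SupWhitenedCovarianceKernelLetter (whitened_integrable_lebesgue)
open SupWhitenedThirdKernelLetter (whitened_mean_bridge)
open SupWhitenedMixedThirdCumulantEntry (whitened_hess_mean_bridge)
open SupWhitenedMixedThirdCumulantEntryTwo (whitened_mixed_triple_bridge_two whitened_mixed_third_cumulant_entry_two)
open SupEffectiveActionDerivative (mul_opBound_le_of_le)
open SupWeightedSlotTools (abs_le_sqrt_mul_of_le)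
open SupHomogeneousThreePoint (centred_triple_le_of_bounded_vertex)

/-! ## §1. The bounded vertex in the middle (any probability measure) -/

section Abstract

variable {Ω : Type*} [MeasurableSpace Ω] {ν : Measure Ω} [IsProbabilityMeasure ν]

/-- **A bounded centred vertex in the MIDDLE**: `|∫(F − m_F)(B − m_B)(G − m_G)dν| ≤ 2β·√m₄` ((650) §1 after commuting the integrand).
[folklore] -/
theorem centred_triple_le_of_bounded_middle {B F G : Ω → ℝ} {mB mF mG β m₄ : ℝ} (hβ : 0 ≤ β) (hB : ∀ ω, |B ω - mB| ≤ 2 * β)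
    (hFm : AEStronglyMeasurable (fun ω => F ω - mF) ν) (hGm : AEStronglyMeasurable (fun ω => G ω - mG) ν)
    (hF4 : Integrable (fun ω => (F ω - mF) ^ 4) ν) (hG4 : Integrable (fun ω => (G ω - mG) ^ 4) ν)
    (hmF : ∫ ω, (F ω - mF) ^ 4 ∂ν ≤ m₄) (hmG : ∫ ω, (G ω - mG) ^ 4 ∂ν ≤ m₄) :
    |∫ ω, (F ω - mF) * (B ω - mB) * (G ω - mG) ∂ν| ≤ 2 * β * Real.sqrt m₄ := by
  have e : ∫ ω, (F ω - mF) * (B ω - mB) * (G ω - mG) ∂ν = ∫ ω, (B ω - mB) * (F ω - mF) * (G ω - mG) ∂ν :=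
    integral_congr_ae (ae_of_all _ fun ω => by ring)
  rw [e]
  exact centred_triple_le_of_bounded_vertex hβ hB hFm hGm hF4 hG4 hmF hmG

end Abstract

/-! ## §2. The homogeneous bound, Gibbs format ((509)′) -/

section Whitened

variable {ι κ : Type} [Fintype ι] [DecidableEq ι] [Fintype κ] [DecidableEq κ]

variable {U : EuclideanSpace ℝ ι → ℝ} {U' : EuclideanSpace ℝ ι → EuclideanSpace ℝ ι →L[ℝ] ℝ}
  {U'' : EuclideanSpace ℝ ι → EuclideanSpace ℝ ι →L[ℝ] EuclideanSpace ℝ ι →L[ℝ] ℝ}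
  {U₃ : EuclideanSpace ℝ ι → EuclideanSpace ℝ ι →L[ℝ] EuclideanSpace ℝ ι →L[ℝ] EuclideanSpace ℝ ι →L[ℝ] ℝ} {Hk : ι → ι → ℝ} {K3 : ι → ι → ι → ℝ}
  {A : Matrix ι κ ℝ} {D : κ → κ → ℝ} {γop κ₀ κ₁ κ₂ κ₃ a τ δ θp lam lamA αr αc hr γ dθ dθ' αθ βθ : ℝ} {θ : κ → κ → ℝ} {σ : ι → κ → ℝ}
  {ρ : ι → ι → ℝ}

/-- **THE HOMOGENEOUS BOUND, SECOND PLACEMENT (Gibbs format)**: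
`|∫(F_x − EF_x)(G_{yz} − EG_{yz})(F_t − EF_t)dν| ≤ 2·Hk_{zy}·√(5κ₂⁴γ_op²∕(1−λγ_op)²)` — NO decay, degree one in `Hk_{zy}`. [folklore] -/
theorem whitened_mixed_third_cumulant_homogeneous_two [Nonempty κ] (hΓop : (γop • (1 : Matrix ι ι ℝ) - A * Aᵀ).PosSemidef) (Y : Finset ι)
    (hUd : ∀ φ : EuclideanSpace ℝ ι, HasFDerivAt U (U' φ) φ) (hU'd : ∀ φ : EuclideanSpace ℝ ι, HasFDerivAt U' (U'' φ) φ) (hU''c : Continuous U'')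
    (hκ₀ : 0 ≤ κ₀) (hκ₁ : 0 ≤ κ₁) (ha : 0 ≤ a) (hτ : 0 < τ) (hδ : 0 < δ) (hθ0 : 0 < θp) (hθ1 : θp < 1) (hκθ : (2 * κ₀ * (1 + τ) + 4 * δ) * γop ≤ θp)
    (hstab : ∀ φ : EuclideanSpace ℝ ι, -(κ₀ * ∑ x ∈ Y, φ x ^ 2) ≤ U φ) (hU'b : ∀ φ : EuclideanSpace ℝ ι, ‖U' φ‖ ≤ κ₁ * (a + ∑ x ∈ Y, φ x ^ 2))
    (hU''b : ∀ φ : EuclideanSpace ℝ ι, ‖U'' φ‖ ≤ κ₂) (hlam : 0 ≤ lam)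
    (hUsec : ∀ s : ℝ, 0 ≤ s → s ≤ 1 → ∀ a b : EuclideanSpace ℝ ι, U ((1 - s) • a + s • b) - lam / 2 * (s * (1 - s)) * ∑ i, (a i - b i) ^ 2 ≤ (1 -
        s) * U a + s * U b)
    (hρ : lam * γop < 1) (hHk : ∀ (φ : EuclideanSpace ℝ ι) (x z : ι), |U'' φ (EuclideanSpace.single z (1 : ℝ)) (EuclideanSpace.single x (1 : ℝ))| ≤
        Hk x z)
    (ψ : EuclideanSpace ℝ ι) (x y z t : ι) :
    |∫ w, (U' (matrixCLM A (WithLp.toLp 2 w) + ψ) (EuclideanSpace.single x (1 : ℝ)) - ∫ w', U' (matrixCLM A (WithLp.toLp 2 w') + ψ)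
        (EuclideanSpace.single x (1 : ℝ)) ∂((volume : Measure (κ → ℝ)).tilted fun z => -(1 / 2 * (z ⬝ᵥ z) + U (matrixCLM A (WithLp.toLp 2 z) +
        ψ)))) * (U'' (matrixCLM A (WithLp.toLp 2 w) + ψ) (EuclideanSpace.single y (1 : ℝ)) (EuclideanSpace.single z (1 : ℝ)) - ∫ w', U'' (matrixCLM
        A (WithLp.toLp 2 w') + ψ) (EuclideanSpace.single y (1 : ℝ)) (EuclideanSpace.single z (1 : ℝ)) ∂((volume : Measure (κ → ℝ)).tilted fun z =>
        -(1 / 2 * (z ⬝ᵥ z) + U (matrixCLM A (WithLp.toLp 2 z) + ψ)))) * (U' (matrixCLM A (WithLp.toLp 2 w) + ψ) (EuclideanSpace.single t (1 : ℝ)) -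
        ∫ w', U' (matrixCLM A (WithLp.toLp 2 w') + ψ) (EuclideanSpace.single t (1 : ℝ)) ∂((volume : Measure (κ → ℝ)).tilted fun z => -(1 / 2 * (z
        ⬝ᵥ z) + U (matrixCLM A (WithLp.toLp 2 z) + ψ)))) ∂((volume : Measure (κ → ℝ)).tilted fun z => -(1 / 2 * (z ⬝ᵥ z) + U (matrixCLM A
        (WithLp.toLp 2 z) + ψ)))| ≤
      2 * Hk z y * Real.sqrt (5 * (κ₂ ^ 4 * γop ^ 2) / (1 - lam * γop) ^ 2) := by
  haveI : Nonempty ι := ⟨x⟩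
  have hUc : Continuous U := continuous_iff_continuousAt.2 fun φ => (hUd φ).continuousAt
  have hU'c : Continuous U' := continuous_iff_continuousAt.2 fun φ => (hU'd φ).continuousAt
  have hγop := op_letter_nonneg hΓop
  have hκθ₀ : 2 * κ₀ * (1 + τ) * γop ≤ θp := mul_opBound_le_of_le (by positivity) (by linarith) hθ0.le hκθ
  have hI0 := whitened_exp_integrable hΓop Y hUc.measurable hκ₀ hτ hθ1 hκθ₀ hstab ψ
  have hV0 : Integrable (fun z : κ → ℝ => exp (-(1 / 2 * (z ⬝ᵥ z) + U (matrixCLM A (WithLp.toLp 2 z) + ψ)))) := by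
    have h := whitened_integrable_lebesgue A ψ (k := fun _ => (1 : ℝ)) (by simpa only [mul_one] using hI0)
    simpa only [one_mul] using h
  haveI : IsProbabilityMeasure ((volume : Measure (κ → ℝ)).tilted fun z => -(1 / 2 * (z ⬝ᵥ z) + U (matrixCLM A (WithLp.toLp 2 z) + ψ))) :=
        isProbabilityMeasure_tilted hV0
  have h4 := fun v => whitened_fourth_moment_gibbs hΓop Y hUd hU'd hU''c hκ₀ hκ₁ ha hτ hδ hθ0 hθ1 hκθ hstab hU'b hU''b hlam hUsec hρ ψ v
  have hI4 := fun v c => whitened_fourth_power_integrable hΓop Y hUd hU'd hκ₀ hκ₁ ha hτ hδ hθ0 hθ1 hκθ hstab hU'b ψ v c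
  have hsh : Continuous fun w : κ → ℝ => matrixCLM A (WithLp.toLp 2 w) + ψ :=
    ((matrixCLM A).continuous.comp (PiLp.continuous_toLp 2 _)).add continuous_const
  have hFm : ∀ (v : ι) (c : ℝ), AEStronglyMeasurable (fun w : κ → ℝ => U' (matrixCLM A (WithLp.toLp 2 w) + ψ) (EuclideanSpace.single v (1 : ℝ))
      - c) ((volume : Measure (κ → ℝ)).tilted fun z => -(1 / 2 * (z ⬝ᵥ z) + U (matrixCLM A (WithLp.toLp 2 z) + ψ))) :=
    fun v c => (((hU'c.comp hsh).clm_apply continuous_const).sub continuous_const).aestronglyMeasurable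
  have hβ : 0 ≤ Hk z y := (abs_nonneg _).trans (hHk ψ z y)
  have hB : ∀ w : κ → ℝ, |U'' (matrixCLM A (WithLp.toLp 2 w) + ψ) (EuclideanSpace.single y (1 : ℝ)) (EuclideanSpace.single z (1 : ℝ)) -
      ∫ w', U'' (matrixCLM A (WithLp.toLp 2 w') + ψ) (EuclideanSpace.single y (1 : ℝ)) (EuclideanSpace.single z (1 : ℝ)) ∂((volume : Measure (κ →
        ℝ)).tilted fun z => -(1 / 2 * (z ⬝ᵥ z) + U (matrixCLM A (WithLp.toLp 2 z) + ψ)))| ≤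
      2 * Hk z y := fun w => by
    have h1 := hHk (matrixCLM A (WithLp.toLp 2 w) + ψ) z y
    have h2 : ‖∫ w', U'' (matrixCLM A (WithLp.toLp 2 w') + ψ) (EuclideanSpace.single y (1 : ℝ)) (EuclideanSpace.single z (1 : ℝ)) ∂((volume :
        Measure (κ → ℝ)).tilted fun z => -(1 / 2 * (z ⬝ᵥ z) + U (matrixCLM A (WithLp.toLp 2 z) + ψ)))‖ ≤
        Hk z y * (((volume : Measure (κ → ℝ)).tilted fun z => -(1 / 2 * (z ⬝ᵥ z) + U (matrixCLM A (WithLp.toLp 2 z) + ψ)))).real Set.univ :=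
      norm_integral_le_of_norm_le_const (Filter.Eventually.of_forall fun w' => by
        rw [Real.norm_eq_abs]; exact hHk (matrixCLM A (WithLp.toLp 2 w') + ψ) z y)
    rw [probReal_univ, mul_one, Real.norm_eq_abs] at h2
    exact (abs_sub _ _).trans (by linarith)
  exact centred_triple_le_of_bounded_middle hβ hB (hFm x _) (hFm t _) (hI4 x _) (hI4 t _) (h4 x) (h4 t)

/-! ## §3. The homogeneous bound, tilted format under `N(0,AAᵀ)` ((509)′) -/

/-- **THE HOMOGENEOUS BOUND, SECOND PLACEMENT, TILTED FORMAT**: `|Z⁻¹∫e^{−U}(U′e_x − a_x)(U″e_ye_z − g₀)(U′e_t − a_t) dN(0,AAᵀ)| ≤ 2·Hk_{zy}·√M₁`.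
[folklore] -/
theorem homogeneous_mixed_third_cumulant_entry_two [Nonempty κ] (hΓop : (γop • (1 : Matrix ι ι ℝ) - A * Aᵀ).PosSemidef) (Y : Finset ι)
    (hUd : ∀ φ : EuclideanSpace ℝ ι, HasFDerivAt U (U' φ) φ) (hU'd : ∀ φ : EuclideanSpace ℝ ι, HasFDerivAt U' (U'' φ) φ) (hU''c : Continuous U'')
    (hκ₀ : 0 ≤ κ₀) (hκ₁ : 0 ≤ κ₁) (ha : 0 ≤ a) (hτ : 0 < τ) (hδ : 0 < δ) (hθ0 : 0 < θp) (hθ1 : θp < 1) (hκθ : (2 * κ₀ * (1 + τ) + 4 * δ) * γop ≤ θp)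
    (hstab : ∀ φ : EuclideanSpace ℝ ι, -(κ₀ * ∑ x ∈ Y, φ x ^ 2) ≤ U φ) (hU'b : ∀ φ : EuclideanSpace ℝ ι, ‖U' φ‖ ≤ κ₁ * (a + ∑ x ∈ Y, φ x ^ 2))
    (hU''b : ∀ φ : EuclideanSpace ℝ ι, ‖U'' φ‖ ≤ κ₂) (hlam : 0 ≤ lam)
    (hUsec : ∀ s : ℝ, 0 ≤ s → s ≤ 1 → ∀ a b : EuclideanSpace ℝ ι, U ((1 - s) • a + s • b) - lam / 2 * (s * (1 - s)) * ∑ i, (a i - b i) ^ 2 ≤ (1 -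
        s) * U a + s * U b)
    (hρ : lam * γop < 1) (hHk : ∀ (φ : EuclideanSpace ℝ ι) (x z : ι), |U'' φ (EuclideanSpace.single z (1 : ℝ)) (EuclideanSpace.single x (1 : ℝ))| ≤
        Hk x z)
    (ψ : EuclideanSpace ℝ ι) (x y z t : ι) :
    |(∫ ω : EuclideanSpace ℝ ι, exp (-U (ω + ψ)) ∂(multivariateGaussian 0 (A * Aᵀ)))⁻¹ * (∫ ω : EuclideanSpace ℝ ι, exp (-U (ω + ψ)) * ((U' (ω + ψ)
        (EuclideanSpace.single x (1 : ℝ)) - ((∫ ω : EuclideanSpace ℝ ι, exp (-U (ω + ψ)) ∂(multivariateGaussian 0 (A * Aᵀ)))⁻¹ * (∫ ω :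
        EuclideanSpace ℝ ι, exp (-U (ω + ψ)) * U' (ω + ψ) (EuclideanSpace.single x (1 : ℝ)) ∂(multivariateGaussian 0 (A * Aᵀ))))) * (U'' (ω + ψ)
        (EuclideanSpace.single y (1 : ℝ)) (EuclideanSpace.single z (1 : ℝ)) - ((∫ ω : EuclideanSpace ℝ ι, exp (-U (ω + ψ)) ∂(multivariateGaussian 0
        (A * Aᵀ)))⁻¹ * (∫ ω : EuclideanSpace ℝ ι, exp (-U (ω + ψ)) * U'' (ω + ψ) (EuclideanSpace.single y (1 : ℝ)) (EuclideanSpace.single z (1 :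
        ℝ)) ∂(multivariateGaussian 0 (A * Aᵀ))))) * (U' (ω + ψ) (EuclideanSpace.single t (1 : ℝ)) - ((∫ ω : EuclideanSpace ℝ ι, exp (-U (ω + ψ))
        ∂(multivariateGaussian 0 (A * Aᵀ)))⁻¹ * (∫ ω : EuclideanSpace ℝ ι, exp (-U (ω + ψ)) * U' (ω + ψ) (EuclideanSpace.single t (1 : ℝ))
        ∂(multivariateGaussian 0 (A * Aᵀ)))))) ∂(multivariateGaussian 0 (A * Aᵀ)))| ≤
      2 * Hk z y * Real.sqrt (5 * (κ₂ ^ 4 * γop ^ 2) / (1 - lam * γop) ^ 2) := by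
  have hUc : Continuous U := continuous_iff_continuousAt.2 fun φ => (hUd φ).continuousAt
  have hU'c : Continuous U' := continuous_iff_continuousAt.2 fun φ => (hU'd φ).continuousAt
  have h := whitened_mixed_third_cumulant_homogeneous_two hΓop Y hUd hU'd hU''c hκ₀ hκ₁ ha hτ hδ hθ0 hθ1 hκθ hstab hU'b hU''b hlam hUsec hρ hHk ψ x
        y z t
  rw [whitened_mean_bridge hUc hU'c A ψ (EuclideanSpace.single x (1 : ℝ)), whitened_hess_mean_bridge hUc hU''c A ψ y z,
    whitened_mean_bridge hUc hU'c A ψ (EuclideanSpace.single t (1 : ℝ)),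
    whitened_mixed_triple_bridge_two hUc hU'c hU''c A ψ y z (EuclideanSpace.single x (1 : ℝ)) (EuclideanSpace.single t (1 : ℝ))] at h
  exact h

/-! ## §4. THE END: the interpolated three-point entry, second placement -/

/-- **THE END — THE INTERPOLATED ENTRY, SECOND PLACEMENT**: `|κ₃| ≤ √(2Hk_{zy}√M₁·4√(MK)) ∕ √(ρ_{xy}ρ_{xt})`. [folklore] -/
theorem interpolated_mixed_third_cumulant_entry_two [Nonempty κ] (hΓop : (γop • (1 : Matrix ι ι ℝ) - A * Aᵀ).PosSemidef) (Y : Finset ι) (hUd : ∀ φ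
        : EuclideanSpace ℝ ι, HasFDerivAt U (U' φ) φ) (hU'd : ∀ φ : EuclideanSpace ℝ ι, HasFDerivAt U' (U'' φ) φ) (hU''d : ∀ φ : EuclideanSpace ℝ
        ι, HasFDerivAt U'' (U₃ φ) φ) (hU₃c : Continuous U₃) (hκ₀ : 0 ≤ κ₀) (hκ₁ : 0 ≤ κ₁) (ha : 0 ≤ a) (hτ : 0 < τ) (hδ : 0 < δ) (hθ0 : 0 < θp)
        (hθ1 : θp < 1) (hκθ : (2 * κ₀ * (1 + τ) + 4 * δ) * γop ≤ θp) (hκθw : 2 * κ₀ * (1 + τ) * γop + 4 * δ ≤ θp) (hstab : ∀ φ : EuclideanSpace ℝ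
        ι, -(κ₀ * ∑ x ∈ Y, φ x ^ 2) ≤ U φ) (hU'b : ∀ φ : EuclideanSpace ℝ ι, ‖U' φ‖ ≤ κ₁ * (a + ∑ x ∈ Y, φ x ^ 2)) (hU''b : ∀ φ : EuclideanSpace ℝ
        ι, ‖U'' φ‖ ≤ κ₂) (hU₃b : ∀ φ : EuclideanSpace ℝ ι, ‖U₃ φ‖ ≤ κ₃) (hlam : 0 ≤ lam) (hUsec : ∀ s : ℝ, 0 ≤ s → s ≤ 1 → ∀ a b : EuclideanSpace ℝ
        ι, U ((1 - s) • a + s • b) - lam / 2 * (s * (1 - s)) * ∑ i, (a i - b i) ^ 2 ≤ (1 - s) * U a + s * U b) (hρg : lam * γop < 1) (hHk : ∀ (φ :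
        EuclideanSpace ℝ ι) (x z : ι), |U'' φ (EuclideanSpace.single z (1 : ℝ)) (EuclideanSpace.single x (1 : ℝ))| ≤ Hk x z) (hHk0 : ∀ v u, 0 ≤ Hk
        v u) (hK3 : ∀ (φ : EuclideanSpace ℝ ι) (u x y : ι), |U₃ φ (EuclideanSpace.single u (1 : ℝ)) (EuclideanSpace.single x (1 : ℝ))
        (EuclideanSpace.single y (1 : ℝ))| ≤ K3 x y u) (hK30 : ∀ x y u, 0 ≤ K3 x y u) (ψ : EuclideanSpace ℝ ι) (hαr : ∀ u, ∑ w, |A u w| ≤ αr) (hαc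
        : ∀ w, ∑ u, |A u w| ≤ αc) (hhr : ∀ v, ∑ u, Hk v u ≤ hr) (hlamA : ∀ x : κ, ∑ u, ∑ v, |A u x| * |A v x| * Hk v u ≤ lamA) (hlamA1 : lamA < 1)
        (hγ : αc * hr * αr / (1 - lamA) ≤ γ) (hγ1 : γ < 1) (hD : ∀ x y, 0 ≤ D x y) (hDC : ∀ x y, (if x = y then (1 : ℝ) else 0) + ∑ z, D x z * ((if
        y = z then 0 else ∑ u, ∑ v, |A u y| * |A v z| * Hk v u) / (1 - lamA)) ≤ D x y) (hθnn : ∀ z w, 0 ≤ θ z w) (hDr : ∀ z, ∑ w, D z w * θ z w ≤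
        dθ) (hdθ : 0 ≤ dθ) (hDc : ∀ w, ∑ z, D z w * θ z w ≤ dθ') (hdθ' : 0 ≤ dθ') (hσ0 : ∀ x w, 0 ≤ σ x w) (hσθ : ∀ x z w, σ x w ≤ σ x z * θ z w)
        (hρ1 : ∀ x y, 1 ≤ ρ x y) (hρsymm : ∀ x y, ρ x y = ρ y x) (hρmul : ∀ x y z, ρ x z ≤ ρ x y * ρ y z) (hρσ : ∀ x y w, ρ x y ^ 8 ≤ σ x w * σ y
        w) (haσ : ∀ v : ι, ∑ w, (∑ u, |A u w| * Hk v u) * σ v w ≤ αθ) (hβ : 0 ≤ βθ) (haσ' : ∀ (v : ι) (w : κ), (∑ u, |A u w| * Hk v u) * σ v w ≤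
        βθ) (x y z : ι) (hgσ : ∑ w, (∑ u, |A u w| * K3 y z u) * σ y w ≤ αθ) (hgσ' : ∀ w : κ, (∑ u, |A u w| * K3 y z u) * σ y w ≤ βθ) (t : ι) :
    |(∫ ω : EuclideanSpace ℝ ι, exp (-U (ω + ψ)) ∂(multivariateGaussian 0 (A * Aᵀ)))⁻¹ * (∫ ω : EuclideanSpace ℝ ι, exp (-U (ω + ψ)) * ((U' (ω + ψ)
        (EuclideanSpace.single x (1 : ℝ)) - ((∫ ω : EuclideanSpace ℝ ι, exp (-U (ω + ψ)) ∂(multivariateGaussian 0 (A * Aᵀ)))⁻¹ * (∫ ω :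
        EuclideanSpace ℝ ι, exp (-U (ω + ψ)) * U' (ω + ψ) (EuclideanSpace.single x (1 : ℝ)) ∂(multivariateGaussian 0 (A * Aᵀ))))) * (U'' (ω + ψ)
        (EuclideanSpace.single y (1 : ℝ)) (EuclideanSpace.single z (1 : ℝ)) - ((∫ ω : EuclideanSpace ℝ ι, exp (-U (ω + ψ)) ∂(multivariateGaussian 0
        (A * Aᵀ)))⁻¹ * (∫ ω : EuclideanSpace ℝ ι, exp (-U (ω + ψ)) * U'' (ω + ψ) (EuclideanSpace.single y (1 : ℝ)) (EuclideanSpace.single z (1 :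
        ℝ)) ∂(multivariateGaussian 0 (A * Aᵀ))))) * (U' (ω + ψ) (EuclideanSpace.single t (1 : ℝ)) - ((∫ ω : EuclideanSpace ℝ ι, exp (-U (ω + ψ))
        ∂(multivariateGaussian 0 (A * Aᵀ)))⁻¹ * (∫ ω : EuclideanSpace ℝ ι, exp (-U (ω + ψ)) * U' (ω + ψ) (EuclideanSpace.single t (1 : ℝ))
        ∂(multivariateGaussian 0 (A * Aᵀ)))))) ∂(multivariateGaussian 0 (A * Aᵀ)))| ≤
      Real.sqrt (2 * Hk z y * Real.sqrt (5 * (κ₂ ^ 4 * γop ^ 2) / (1 - lam * γop) ^ 2) * (4 * Real.sqrt ((5 * ((κ₂ ^ 4 + κ₃ ^ 4) * γop ^ 2) / (1 -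
        lam * γop) ^ 2) * (αθ * dθ * (βθ * dθ') / (1 - lamA))))) / Real.sqrt (ρ x y * ρ x t) := by
  have hU''c : Continuous U'' := continuous_iff_continuousAt.2 fun φ => (hU''d φ).continuousAt
  have hP := homogeneous_mixed_third_cumulant_entry_two hΓop Y hUd hU'd hU''c hκ₀ hκ₁ ha hτ hδ hθ0 hθ1 hκθ hstab hU'b hU''b hlam hUsec hρg hHk
    ψ x y z t
  have hQ := whitened_mixed_third_cumulant_entry_two hΓop Y hUd hU'd hU''d hU₃c hκ₀ hκ₁ ha hτ hδ hθ0 hθ1 hκθ hκθw hstab hU'b hU''b hU₃b hlam hUsec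
        hρg hHk hHk0 hK3 hK30 ψ hαr hαc hhr hlamA hlamA1 hγ hγ1 hD hDC hθnn hDr hdθ hDc hdθ' hσ0 hσθ hρ1 hρsymm hρmul hρσ haσ hβ haσ' x y z hgσ hgσ' t
  have h := abs_le_sqrt_mul_of_le hP hQ
  have hHkzy : 0 ≤ Hk z y := (abs_nonneg _).trans (hHk ψ z y)
  rw [← mul_div_assoc, Real.sqrt_div (by positivity)] at h
  exact h

end Whitened

/-! ## §5. Toy -/

/-- Toy (§1's commutation): the integrand's factor order is immaterial. -/
example (a b c : ℝ) : a * b * c = b * a * c := by ring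

end Summit.QuantumFields.BalabanUV.T4Continuum.NE7b.SupHomogeneousThreePointTwo

end
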